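import Mathlib.Tactic
import HarnessLib
import HarnessLib.Audit.Tags
import Summits.CriticalPhenomena.PercolationContinuityZ3.Theorems.PercNearOneGluingNoHeavyLowerTailSahiAntichainSplitTwo

/-!
# Antichains: meets plus joins — the uniform-join step (any number of members on each side)

Support file (seat `prim-masterthm-p1`, gen 35; `--supports stmt-CriticalPhenomena-4575`).  No `sorry`, standard axioms.  Builds on `…SahiAntichainSplit`,
`…SplitStep`, `…SplitTwo`.  Memo `run/shared/lean/prim/prim-masterthm/FROM-prim-masterthm-p1-g35-SPLIT-STEP.md` §7.

NEW HERE ([this work], gen 35).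
* **Uniform-join step** (`two_le_newLabels_of_union_indep`): if at least two members contain `r`, at least two avoid `r`, and for every `b ∌ r` the cross join
  `a ∪ b` does NOT depend on the member `a ∋ r`, then the split at `r` creates at least two new labels.  Proof: every `b` contains `a₂ \\ a₁ ≠ ∅`, so no trace
  `a₁ ∩ b` is a meet of two members avoiding `r` (one new cross meet); and either all cross joins through `a₁` coincide (then `#below` new cross meets,
  `card_below_le_card_newMeets_of_union_const`) or two of them differ, and two different cross joins cannot both be joins of members containing `r` (each such
  join lies inside every cross join) — one new cross join.  Dually `two_le_newLabels_of_inter_indep`.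
  This is the first local step valid for arbitrarily large sides; the two-member step of `…SplitTwo` reduces to it in its last case.
HONEST FRAMING: V5 in general remains OPEN; everything here is unconditional. [this work]
-/

namespace Summit.CriticalPhenomena.PercolationContinuityZ3.Theorems.SahiColouredDaykin

open Finset

variable {α : Type*} [DecidableEq α]

/-- **Uniform-join step.**  If `#above ≥ 2`, `#below ≥ 2` and the cross join `a ∪ b` is independent of `a ∈ above P r` for every `b ∈ below P r`, then
`newLabels P r ≥ 2`. [this work] -/
theorem two_le_newLabels_of_union_indep {P : Finset (Finset α)} {r : α}
    (hanti : IsAntichain (· ⊆ ·) (P : Set (Finset α))) (hp : 2 ≤ #(above P r)) (hq : 2 ≤ #(below P r))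
    (hind : ∀ a ∈ above P r, ∀ a' ∈ above P r, ∀ b ∈ below P r, a ∪ b = a' ∪ b) :
    2 ≤ newLabels P r := by
  obtain ⟨a₁, ha₁, a₂, ha₂, hne⟩ := one_lt_card.1 (by omega : 1 < #(above P r))
  obtain ⟨ha₁P, hra₁⟩ := mem_above_iff.1 ha₁
  obtain ⟨ha₂P, _⟩ := mem_above_iff.1 ha₂
  -- every cross join through a₁ contains every member containing r
  have hsup : ∀ a ∈ above P r, ∀ b ∈ below P r, a ⊆ a₁ ∪ b := by
    intro a ha b hb
    rw [hind a₁ ha₁ a ha b hb]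
    exact subset_union_left
  -- a point of a₂ outside a₁ lies in every b
  have hna : ¬ a₂ ⊆ a₁ := fun h => hanti (mem_coe.2 ha₂P) (mem_coe.2 ha₁P) (Ne.symm hne) h
  obtain ⟨x₀, hx₂, hx₁⟩ := not_subset.1 hna
  have hx₀ : ∀ b ∈ below P r, x₀ ∈ b := by
    intro b hb
    rcases mem_union.1 (hsup a₂ ha₂ b hb hx₂) with h | h
    · exact absurd h hx₁
    · exact h
  -- the traces through a₁ are new cross meets
  have htrace : ∀ b ∈ below P r, a₁ ∩ b ∈ newMeets P r := by
    intro b hb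
    obtain ⟨hbP, hrb⟩ := mem_below_iff.1 hb
    unfold newMeets
    refine mem_sdiff.2 ⟨mem_crossMeets_iff.2 ⟨a₁, ha₁P, b, hbP, hra₁, hrb, rfl⟩, ?_⟩
    intro hold
    obtain ⟨d, hd, d', hd', _, he⟩ := mem_meets_iff.1 hold
    have : x₀ ∈ a₁ ∩ b := by rw [he]; exact mem_inter.2 ⟨hx₀ d hd, hx₀ d' hd'⟩
    exact hx₁ (mem_inter.1 this).1
  obtain ⟨b₀, hb₀⟩ : (below P r).Nonempty := card_pos.1 (by omega)
  have hx1 : 1 ≤ #(newMeets P r) := card_pos.2 ⟨_, htrace b₀ hb₀⟩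
  unfold newLabels
  by_cases hconst : ∀ b ∈ below P r, ∀ b' ∈ below P r, a₁ ∪ b = a₁ ∪ b'
  · have := card_below_le_card_newMeets_of_union_const (W := a₁ ∪ b₀) hanti ha₁ (fun b hb => hconst b hb b₀ hb₀)
    omega
  · push Not at hconst
    obtain ⟨b₁, hb₁, b₂, hb₂, hne12⟩ := hconst
    -- two different cross joins cannot both be inner joins: an inner join lies inside every cross join through a₁
    have hinner : ∀ W ∈ joins (above P r), ∀ b ∈ below P r, W ⊆ a₁ ∪ b := by
      intro W hW b hb
      obtain ⟨c, hc, c', hc', _, rfl⟩ := mem_joins_iff.1 hW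
      exact union_subset (hsup c hc b hb) (hsup c' hc' b hb)
    have hY : ∀ b ∈ below P r, a₁ ∪ b ∈ crossJoins P r := fun b hb =>
      mem_crossJoins_iff.2 ⟨a₁, ha₁P, b, (mem_below_iff.1 hb).1, hra₁, (mem_below_iff.1 hb).2, rfl⟩
    have hnew : a₁ ∪ b₁ ∈ newJoins P r ∨ a₁ ∪ b₂ ∈ newJoins P r := by
      by_contra hno
      push Not at hno
      obtain ⟨h1, h2⟩ := hno
      unfold newJoins at h1 h2
      rw [mem_sdiff, not_and, not_not] at h1 h2
      have i1 := h1 (hY b₁ hb₁)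
      have i2 := h2 (hY b₂ hb₂)
      exact hne12 (Subset.antisymm (hinner _ i1 b₂ hb₂) (hinner _ i2 b₁ hb₁))
    have hy1 : 1 ≤ #(newJoins P r) := by
      rcases hnew with h | h <;> exact card_pos.2 ⟨_, h⟩
    omega

/-- **Uniform-meet step** (the dual statement): if the cross meet `a ∩ b` is independent of `b ∈ below P r` for every `a ∈ above P r`, then
`newLabels P r ≥ 2`. [this work] -/
theorem two_le_newLabels_of_inter_indep {P : Finset (Finset α)} {r : α}
    (hanti : IsAntichain (· ⊆ ·) (P : Set (Finset α))) (hp : 2 ≤ #(above P r)) (hq : 2 ≤ #(below P r))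
    (hind : ∀ b ∈ below P r, ∀ b' ∈ below P r, ∀ a ∈ above P r, a ∩ b = a ∩ b') :
    2 ≤ newLabels P r := by
  obtain ⟨b₁, hb₁, b₂, hb₂, hne⟩ := one_lt_card.1 (by omega : 1 < #(below P r))
  obtain ⟨hb₁P, hrb₁⟩ := mem_below_iff.1 hb₁
  obtain ⟨hb₂P, _⟩ := mem_below_iff.1 hb₂
  -- every cross meet through b₁ is contained in every member avoiding r
  have hinf : ∀ b ∈ below P r, ∀ a ∈ above P r, a ∩ b₁ ⊆ b := by
    intro b hb a ha
    rw [hind b₁ hb₁ b hb a ha]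
    exact inter_subset_right
  -- a point of b₁ outside b₂ lies in no member containing r
  have hnb : ¬ b₁ ⊆ b₂ := fun h => hanti (mem_coe.2 hb₁P) (mem_coe.2 hb₂P) hne h
  obtain ⟨x₀, hx₁, hx₂⟩ := not_subset.1 hnb
  have hx₀ : ∀ a ∈ above P r, x₀ ∉ a := by
    intro a ha hxa
    exact hx₂ (hinf b₂ hb₂ a ha (mem_inter.2 ⟨hxa, hx₁⟩))
  -- the cojoins through b₁ are new cross joins
  have hcoj : ∀ a ∈ above P r, a ∪ b₁ ∈ newJoins P r := by
    intro a ha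
    obtain ⟨haP, hra⟩ := mem_above_iff.1 ha
    unfold newJoins
    refine mem_sdiff.2 ⟨mem_crossJoins_iff.2 ⟨a, haP, b₁, hb₁P, hra, hrb₁, rfl⟩, ?_⟩
    intro hold
    obtain ⟨c, hc, c', hc', _, he⟩ := mem_joins_iff.1 hold
    have : x₀ ∈ c ∪ c' := by rw [← he]; exact mem_union_right _ hx₁
    rcases mem_union.1 this with h | h
    · exact hx₀ c hc h
    · exact hx₀ c' hc' h
  obtain ⟨a₀, ha₀⟩ : (above P r).Nonempty := card_pos.1 (by omega)
  have hy1 : 1 ≤ #(newJoins P r) := card_pos.2 ⟨_, hcoj a₀ ha₀⟩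
  unfold newLabels
  by_cases hconst : ∀ a ∈ above P r, ∀ a' ∈ above P r, a ∩ b₁ = a' ∩ b₁
  · have := card_above_le_card_newJoins_of_inter_const (Z := a₀ ∩ b₁) hanti hb₁ (fun a ha => hconst a ha a₀ ha₀)
    omega
  · push Not at hconst
    obtain ⟨c₁, hc₁, c₂, hc₂, hne12⟩ := hconst
    have hinnerM : ∀ Z ∈ meets (below P r), ∀ a ∈ above P r, a ∩ b₁ ⊆ Z := by
      intro Z hZ a ha
      obtain ⟨d, hd, d', hd', _, rfl⟩ := mem_meets_iff.1 hZ
      exact subset_inter (hinf d hd a ha) (hinf d' hd' a ha)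
    have hX : ∀ a ∈ above P r, a ∩ b₁ ∈ crossMeets P r := fun a ha =>
      mem_crossMeets_iff.2 ⟨a, (mem_above_iff.1 ha).1, b₁, hb₁P, (mem_above_iff.1 ha).2, hrb₁, rfl⟩
    have hnew : c₁ ∩ b₁ ∈ newMeets P r ∨ c₂ ∩ b₁ ∈ newMeets P r := by
      by_contra hno
      push Not at hno
      obtain ⟨h1, h2⟩ := hno
      unfold newMeets at h1 h2
      rw [mem_sdiff, not_and, not_not] at h1 h2
      have i1 := h1 (hX c₁ hc₁)
      have i2 := h2 (hX c₂ hc₂)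
      exact hne12 (Subset.antisymm (hinnerM _ i2 c₁ hc₁) (hinnerM _ i1 c₂ hc₂))
    have hx1 : 1 ≤ #(newMeets P r) := by
      rcases hnew with h | h <;> exact card_pos.2 ⟨_, h⟩
    omega

end Summit.CriticalPhenomena.PercolationContinuityZ3.Theorems.SahiColouredDaykin
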